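import Summits.BirchSwinnertonDyer.Rank1Residual.X11b.AnticyclotomicModuleFinite
import HarnessLib

/-!
# Route `CumulativeHeegnerLeopoldt`, crux K1 `CumulativeHeegnerInclusionAtThree` (stmt-BirchSwinnertonDyer-24198),
# line `birth` v3, STUB B1 `stub_residualSelmerFinite`: DÉVISSAGE OF THE RESIDUAL SELMER LIFTS ALONG
# `0 → A → E[p] → C → 0`

Second brick for the registered stub B1 (finiteness of `Sel_{𝔭′}(K_∞, E[3^∞])[3]` on the Leopoldt cell), after
the Kummer-lift reduction (`…StubResidualSelmerFiniteReductions.lean`: B1 ⟺ finiteness of the residual lifts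
`L = {y ∈ H¹(K_∞, E[p]) | ι y ∈ Sel}`). The printed method (Castella–Grossi–Lee–Skinner 2022 §3.3, arXiv:2008.02571
§1.4 Prop. 17) bounds the residual Selmer group of `E[p]` by those of the two CHARACTERS `φ, ψ` of
`E[p]^ss = 𝔽_p(φ) ⊕ 𝔽_p(ψ)` through the cohomology sequence of `0 → 𝔽_p(φ) → E[p] → 𝔽_p(ψ) → 0`. This file
proves the GENERIC cohomological dévissage that this step needs, on the tree's continuous `H¹` of discrete
modules (Mathlib `ContinuousCohomology` through `Literature.…discreteH1`), and specialises it to `L`: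

* §1 (any topological group `G`, discrete `G`-modules `A ↪ B ↠ C` exact, continuous orbit maps on `B`)
  **`exists_resH1Hom_eq_of_resH1Hom_eq_zero`** — exactness of `H¹(G, A) → H¹(G, B) → H¹(G, C)` at the middle term
  (Serre, *Galois Cohomology* I.§2.2: lift the bounding element of `C` to `B`, subtract the coboundary, restrict
  values to `A` by `contOneCocycles.lift`); and
  **`finite_of_finite_image_of_finite_lifts`** — an additive subgroup `S ≤ H¹(G, B)` whose image in `H¹(G, C)` is
  finite and whose preimage in `H¹(G, A)` is finite is finite (fibres of `S → H¹(G, C)` are translates of the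
  image of the preimage).
* §2 (every elliptic `E/K`, `p`, `ℤ_p`-extension `κ`, `𝔭`, `Σ`; any `Γ_K`-equivariant exact `A ↪ E[p] ↠ C` of discrete
  `Γ_K`-modules) **`finite_lifts_of_devissage`** / **`finite_pTorsion_of_devissage`**: the residual lifts `L` — and
  hence `Sel_𝔭^Σ(K_∞, E[p^∞])[p]` — are finite as soon as the image of `L` in `H¹(K_∞, C)` and the preimage of `L` in
  `H¹(K_∞, A)` are finite. With `A = Φ` (the rational line of the cell, base-changed to `K`) and `C = E[3]/Φ` this
  is CGLS Prop. 17's reduction of B1 to the two CHARACTER Selmer conditions; constructing `Φ_K ↪ E[3] ↠ E[3]/Φ_K` as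
  discrete `Γ_K`-modules and bounding the two character sets (CGLS Thm. 11: Rubin's main conjecture + μ = 0,
  Oukhaba–Viguié 2016 at `p = 3`) is what remains of B1.

THEOREMS ONLY (`--supports stmt-BirchSwinnertonDyer-24198`); no definition, no named fact, no `sorry`. §1 is generic
Galois-cohomology folklore kept next to its first consumer (a librarian may re-home it under
`Literature/NumberTheory/GaloisRepresentations/`). Seat bsd-line-chl-k1-p1-w2 (width prover, stub B1). BSD is not
proved by any of this.

References: [SerreGaloisCohomology1997] I.§2.2–§2.3 (the exact sequence of cohomology); [CastellaGrossiLeeSkinner2022]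
Prop. 17 (arXiv:2008.02571 §1.4); [GreenbergLNM1716] §5 p. 114.
-/

set_option autoImplicit false
set_option linter.dupNamespace false

noncomputable section

open scoped Classical

namespace Summit.BirchSwinnertonDyer.BirchSwinnertonDyer.Theorems.CumulativeHeegnerInclusionAtThreeStubB1Devissage

open Literature.NumberTheory.EllipticCurves Literature.NumberTheory.GaloisRepresentations
  NumberField IsDedekindDomain Field WeierstrassCurve
  Summit.BirchSwinnertonDyer.Rank1Residual.X11b Summit.BirchSwinnertonDyer.Rank1Residual.X11b.AcSelmer

universe u

/-! ### §1 Generic dévissage for `H¹` of discrete modules -/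

section Generic

variable {G : Type u} [Group G] [TopologicalSpace G] [IsTopologicalGroup G]
variable {A : Type u} [AddCommGroup A] [DistribMulAction G A] [TopologicalSpace A] [DiscreteTopology A]
variable {B : Type u} [AddCommGroup B] [DistribMulAction G B] [TopologicalSpace B] [DiscreteTopology B]
variable {C : Type u} [AddCommGroup C] [DistribMulAction G C] [TopologicalSpace C] [DiscreteTopology C]

/-- **Exactness of `H¹(G, A) → H¹(G, B) → H¹(G, C)` at `H¹(G, B)`** for an exact sequence
`A —ι→ B —π→ C` of discrete `G`-modules with `ι` injective, `π` surjective and `ker π ⊆ im ι` (continuous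
cohomology; the orbit maps of `B` are continuous). If `π_* y = 0` then `y = ι_* x` for some `x`: represent `y`
by a continuous crossed homomorphism `φ`; `π ∘ φ = ∂c`, `c = π b`; then `φ − ∂b` takes values in `ker π = ι(A)`
and restricts to a continuous cocycle of `A` (`contOneCocycles.lift`).
[cite: SerreGaloisCohomology1997, I.§2.2 (Prop. 2, exact sequence of cohomology)] -/
theorem exists_resH1Hom_eq_of_resH1Hom_eq_zero (ι : A →+ B)
    (hι : ∀ (g : G) (a : A), ι (ContinuousMonoidHom.id G g • a) = g • ι a) (hinj : Function.Injective ι)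
    (π : B →+ C) (hπ : ∀ (g : G) (b : B), π (ContinuousMonoidHom.id G g • b) = g • π b)
    (hsurj : Function.Surjective π) (hexact : ∀ b : B, π b = 0 → ∃ a : A, ι a = b)
    (hcontB : ∀ b : B, Continuous fun g : G ↦ g • b)
    {y : discreteH1 G B} (hy : resH1Hom (ContinuousMonoidHom.id G) π hπ y = 0) :
    ∃ x : discreteH1 G A, resH1Hom (ContinuousMonoidHom.id G) ι hι x = y := by
  obtain ⟨φ, rfl⟩ := oneCocycleClass_surjective _ y
  rw [resH1Hom_id_oneCocycleClass, oneCocycleClass_eq_zero_iff] at hy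
  obtain ⟨c, hc⟩ := hy
  have hc' : ∀ g : G, π (φ.1 g) = g • c - c := fun g ↦ hc g
  obtain ⟨b, rfl⟩ := hsurj c
  have hπ' : ∀ (g : G) (b : B), π (g • b) = g • π b := hπ
  -- `φ' = φ - ∂b` takes values in `ker π`
  set φ' := φ - cobCocycle b (hcontB b) with hφ'
  have hval : ∀ g : G, π (φ'.1 g) = 0 := fun g ↦ by
    change π (φ.1 g - (g • b - b)) = 0
    rw [map_sub, map_sub, hπ', hc', sub_self]
  choose s hs using fun g ↦ hexact _ (hval g)
  refine ⟨oneCocycleClass _ (contOneCocycles.lift ι hι hinj φ' s hs), ?_⟩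
  rw [resH1Hom_id_oneCocycleClass, contOneCocycles.push_lift, hφ', oneCocycleClass_sub,
    oneCocycleClass_cobCocycle, sub_zero]

/-- **Dévissage of finiteness along `H¹(G, A) → H¹(G, B) → H¹(G, C)`.** For an additive subgroup
`S ≤ H¹(G, B)`: if its image `π_* S ⊆ H¹(G, C)` is finite and its preimage `{x ∈ H¹(G, A) | ι_* x ∈ S}` is finite,
then `S` is finite — two elements of `S` with the same image under `π_*` differ by `ι_* x` with `ι_* x ∈ S`
(middle exactness, `exists_resH1Hom_eq_of_resH1Hom_eq_zero`), so each fibre of `π_*|_S` is a translate of a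
finite set. [cite: SerreGaloisCohomology1997, I.§2.2 (Prop. 2, exact sequence of cohomology)] -/
theorem finite_of_finite_image_of_finite_lifts (ι : A →+ B)
    (hι : ∀ (g : G) (a : A), ι (ContinuousMonoidHom.id G g • a) = g • ι a) (hinj : Function.Injective ι)
    (π : B →+ C) (hπ : ∀ (g : G) (b : B), π (ContinuousMonoidHom.id G g • b) = g • π b)
    (hsurj : Function.Surjective π) (hexact : ∀ b : B, π b = 0 → ∃ a : A, ι a = b)
    (hcontB : ∀ b : B, Continuous fun g : G ↦ g • b)
    (S : AddSubgroup (discreteH1 G B))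
    (himage : Set.Finite ((resH1Hom (ContinuousMonoidHom.id G) π hπ) '' (S : Set (discreteH1 G B))))
    (hpre : Set.Finite {x : discreteH1 G A | resH1Hom (ContinuousMonoidHom.id G) ι hι x ∈ S}) :
    Set.Finite (S : Set (discreteH1 G B)) := by
  let πH := resH1Hom (ContinuousMonoidHom.id G) π hπ
  let ιH := resH1Hom (ContinuousMonoidHom.id G) ι hι
  -- `S ⊆ ⋃_{t ∈ π_* S} (S ∩ π_*⁻¹ t)`
  have hsub : (S : Set (discreteH1 G B)) ⊆ ⋃ t ∈ πH '' (S : Set (discreteH1 G B)), {y | y ∈ S ∧ πH y = t} := by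
    intro y hy
    simp only [Set.mem_iUnion, Set.mem_setOf_eq, exists_prop]
    exact ⟨πH y, ⟨y, hy, rfl⟩, hy, rfl⟩
  refine (himage.biUnion fun t _ ↦ ?_).subset hsub
  by_cases hne : {y : discreteH1 G B | y ∈ S ∧ πH y = t}.Nonempty
  · obtain ⟨y₀, hy₀S, hy₀⟩ := hne
    -- the fibre through `y₀` is contained in `y₀ + ι_*(preimage)`
    refine ((hpre.image ιH).image fun z ↦ y₀ + z).subset ?_
    rintro y ⟨hyS, hy⟩
    have hker : πH (y - y₀) = 0 := by rw [map_sub, hy, hy₀, sub_self]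
    obtain ⟨x, hx⟩ := exists_resH1Hom_eq_of_resH1Hom_eq_zero ι hι hinj π hπ hsurj hexact hcontB hker
    refine ⟨ιH x, ⟨x, ?_, rfl⟩, ?_⟩
    · show ιH x ∈ S
      rw [hx]
      exact S.sub_mem hyS hy₀S
    · show y₀ + ιH x = y
      rw [hx]; abel
  · rw [Set.not_nonempty_iff_eq_empty.mp hne]
    exact Set.finite_empty

end Generic

/-! ### §2 The residual lifts of Castella's Selmer group along `0 → A → E[p] → C → 0` -/

section Curve

variable {K : Type u} [Field K] [NumberField K] (W : WeierstrassCurve K) (p : ℕ) [hp : Fact p.Prime]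
  (κ : ZpExtension K p) (𝔭 : HeightOneSpectrum (𝓞 K)) (S : Set (HeightOneSpectrum (𝓞 K)))

variable {A : Type u} [AddCommGroup A] [DistribMulAction (absoluteGaloisGroup K) A] [TopologicalSpace A]
  [DiscreteTopology A]
variable {C : Type u} [AddCommGroup C] [DistribMulAction (absoluteGaloisGroup K) C] [TopologicalSpace C]
  [DiscreteTopology C]

/-- The subgroup of RESIDUAL LIFTS `L = {y ∈ H¹(K_∞, E[p]) | ι y ∈ Sel_𝔭^Σ(K_∞, E[p^∞])}` (the preimage of
Castella's Selmer group under the Kummer comparison) is finite as soon as, for SOME `Γ_K`-equivariant exact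
sequence `0 → A —j→ E[p] —q→ C → 0` of discrete `Γ_K`-modules, the image of `L` in `H¹(K_∞, C)` and the preimage
of `L` in `H¹(K_∞, A)` are finite — the dévissage of CGLS Prop. 17 on the tree's objects (`A = 𝔽_p(φ)`,
`C = 𝔽_p(ψ)` there). [cite: CastellaGrossiLeeSkinner2022, Prop. 17 (arXiv:2008.02571 §1.4)] [cite: SerreGaloisCohomology1997, I.§2.2] -/
theorem finite_lifts_of_devissage [W.IsElliptic]
    (j : A →+ W.geomTorsion (p : ℤ)) (hj : ∀ (σ : absoluteGaloisGroup K) (a : A), j (σ • a) = σ • j a)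
    (hjinj : Function.Injective j)
    (q : W.geomTorsion (p : ℤ) →+ C) (hq : ∀ (σ : absoluteGaloisGroup K) (m : W.geomTorsion (p : ℤ)),
      q (σ • m) = σ • q m)
    (hqsurj : Function.Surjective q) (hexact : ∀ m : W.geomTorsion (p : ℤ), q m = 0 → ∃ a : A, j a = m)
    (himage : Set.Finite ((resH1Hom (ContinuousMonoidHom.id κ.kerSubgroup) q
        (fun (g : κ.kerSubgroup) m ↦ hq (g : absoluteGaloisGroup K) m)) ''
        {y : Literature.NumberTheory.EllipticCurves.subgroupH1 κ.kerSubgroup (W.geomTorsion (p : ℤ)) |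
          W.torsionToPrimaryH1Sub p κ.kerSubgroup y ∈ selmerAc W p κ 𝔭 S}))
    (hpre : Set.Finite {x : Literature.NumberTheory.EllipticCurves.subgroupH1 κ.kerSubgroup A |
        W.torsionToPrimaryH1Sub p κ.kerSubgroup
          (resH1Hom (ContinuousMonoidHom.id κ.kerSubgroup) j
            (fun (g : κ.kerSubgroup) a ↦ hj (g : absoluteGaloisGroup K) a) x) ∈ selmerAc W p κ 𝔭 S}) :
    Set.Finite {y : Literature.NumberTheory.EllipticCurves.subgroupH1 κ.kerSubgroup (W.geomTorsion (p : ℤ)) |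
        W.torsionToPrimaryH1Sub p κ.kerSubgroup y ∈ selmerAc W p κ 𝔭 S} := by
  haveI : ContinuousSMul (absoluteGaloisGroup K) (W.geomTorsion (p : ℤ)) :=
    W.continuousSMul_geomTorsion (W.isOpen_stabilizer_point_holds) _
  have hcont : ∀ m : W.geomTorsion (p : ℤ), Continuous fun g : κ.kerSubgroup ↦ g • m := fun m ↦
    continuous_subtype_val.smul continuous_const
  let L : AddSubgroup (Literature.NumberTheory.EllipticCurves.subgroupH1 κ.kerSubgroup (W.geomTorsion (p : ℤ))) :=
    (selmerAc W p κ 𝔭 S).comap (W.torsionToPrimaryH1Sub p κ.kerSubgroup)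
  have hL : (L : Set _) = {y | W.torsionToPrimaryH1Sub p κ.kerSubgroup y ∈ selmerAc W p κ 𝔭 S} := rfl
  rw [← hL]
  exact finite_of_finite_image_of_finite_lifts (G := κ.kerSubgroup) j
    (fun (g : κ.kerSubgroup) a ↦ hj (g : absoluteGaloisGroup K) a) hjinj q
    (fun (g : κ.kerSubgroup) m ↦ hq (g : absoluteGaloisGroup K) m) hqsurj hexact hcont L himage hpre

/-- **B1's conclusion by dévissage**: under the hypotheses of `finite_lifts_of_devissage`,
`Sel_𝔭^Σ(K_∞, E[p^∞])[p]` is finite (Kummer lift `exists_torsionToPrimaryH1Sub_eq`; cf. the landed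
`CumulativeHeegnerInclusionAtThreeStubB1.finite_pTorsion_of_finite_lifts`).
[cite: CastellaGrossiLeeSkinner2022, Prop. 17–18 (arXiv:2008.02571 §1.4)] [cite: GreenbergLNM1716, §5 p. 114] -/
theorem finite_pTorsion_of_devissage [W.IsElliptic]
    (j : A →+ W.geomTorsion (p : ℤ)) (hj : ∀ (σ : absoluteGaloisGroup K) (a : A), j (σ • a) = σ • j a)
    (hjinj : Function.Injective j)
    (q : W.geomTorsion (p : ℤ) →+ C) (hq : ∀ (σ : absoluteGaloisGroup K) (m : W.geomTorsion (p : ℤ)),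
      q (σ • m) = σ • q m)
    (hqsurj : Function.Surjective q) (hexact : ∀ m : W.geomTorsion (p : ℤ), q m = 0 → ∃ a : A, j a = m)
    (himage : Set.Finite ((resH1Hom (ContinuousMonoidHom.id κ.kerSubgroup) q
        (fun (g : κ.kerSubgroup) m ↦ hq (g : absoluteGaloisGroup K) m)) ''
        {y : Literature.NumberTheory.EllipticCurves.subgroupH1 κ.kerSubgroup (W.geomTorsion (p : ℤ)) |
          W.torsionToPrimaryH1Sub p κ.kerSubgroup y ∈ selmerAc W p κ 𝔭 S}))
    (hpre : Set.Finite {x : Literature.NumberTheory.EllipticCurves.subgroupH1 κ.kerSubgroup A |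
        W.torsionToPrimaryH1Sub p κ.kerSubgroup
          (resH1Hom (ContinuousMonoidHom.id κ.kerSubgroup) j
            (fun (g : κ.kerSubgroup) a ↦ hj (g : absoluteGaloisGroup K) a) x) ∈ selmerAc W p κ 𝔭 S}) :
    Set.Finite {s : selmerAc W p κ 𝔭 S | p • s = 0} := by
  -- same two lines as `CumulativeHeegnerInclusionAtThreeStubB1.finite_pTorsion_of_finite_lifts`, inlined to keep
  -- this file independent of the route file (theses cone)
  have hfin := finite_lifts_of_devissage W p κ 𝔭 S j hj hjinj q hq hqsurj hexact himage hpre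
  refine ((hfin.image (W.torsionToPrimaryH1Sub p κ.kerSubgroup)).preimage
    Subtype.val_injective.injOn).subset ?_
  intro s hs
  have hps : p • (s : W.subgroupH1 p κ.kerSubgroup) = 0 := by
    rw [← AddSubgroupClass.coe_nsmul, hs, ZeroMemClass.coe_zero]
  obtain ⟨y, hy⟩ := W.exists_torsionToPrimaryH1Sub_eq p (H := κ.kerSubgroup)
    W.zsmul_geomPoints_surjective_holds hps
  refine ⟨y, ?_, hy⟩
  show W.torsionToPrimaryH1Sub p κ.kerSubgroup y ∈ selmerAc W p κ 𝔭 S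
  rw [hy]
  exact s.2

end Curve

end Summit.BirchSwinnertonDyer.BirchSwinnertonDyer.Theorems.CumulativeHeegnerInclusionAtThreeStubB1Devissage

end
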